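import Mathlib
import Summits.KontsevichZagierPeriods.Zeta5Search.BrickLambdaClosedForm

/-!
# BrickLambdaLocality — THEOREM 7 LEMMA 3 (v) for the ° cells: DIGIT-LOCALITY of the multiplier,
`λ_{j'} ≡ λ_j (mod p^e)` for `j' = j + p^e q` with the same bottom digit (Gauss–Wilson blocks; cell zeta5-irr)

HONEST FRAMING: systematic search; no irrationality claim unless certified. INSTRUMENT lemmas of the ζ(5)
census cell zeta5-irr (HOME `run/shared/lean/pub/zeta5-irr/`; memo `zi-p2/probes/B8/thm7/THEOREM7.md` §2 LEMMA 3
«(v) DIGIT-LOCALITY: for every e ≥ 1 and cells K, K* = K + p^et ≤ N with K₀ ≤ N₀ (so K*₀ = K₀ and the two cells have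
the same indicators c_h = 0, c_a, δ_b, c_c): λ_{K*} ≡ λ_K (mod p^e). Proof: by (W), each of K*!_p/K!_p, (N−K)!_p/(N−K*)!_p,
(N+K*)!_p/(N+K)!_p, (2N−K)!_p/(2N−K*)!_p is a product over t blocks of p^e consecutive integers, hence ≡ (−1)^t (mod p^e)
… the signs (−1)^t cancel in pairs. The p-multiples p·y_a, p·y_b change by ±p^e t ≡ 0, and (N−2K*)/2 − (N−2K)/2 =
−p^et»; `zi-p2/probes/B8/thm8/THEOREM8.md` fact (°), Q-3). Nothing here is about ζ(5); no irrationality content;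
filing moves no rung. Filed by the engine seat zi-eng (g9); sequel of `BrickLambdaClosedForm` (`λ_j·U_j = σ·(n/2−j)^ε·Y_j`)
on `GaussWilsonBlock.unitFactorial_shift_iter` (zi-p2's SketchT7 v2, filed by zi-eng g8).

## The statements (digits subtraction-free: `n₀ = j₀ + m₀`, `N = J + M = J' + M'`, `J'p = Jp + p^e q`)

* `unitPart_zmod_eq`: `U_{j'} = U_j` in `ZMod (p^e)`; `gainPart_zmod_eq`: `Y_{j'} = Y_j` in `ZMod (p^e)`;
* **`lambda_digit_local`** (`A` even, odd `p`): for any `λ, λ'` with `λ·c̃_{J,A}(N) = c_{j,A}(n)`,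
  `λ'·c̃_{J',A}(N) = c_{j',A}(n)`: `v(λ' − λ) ≤ exp(−e)`.
-/

namespace Summit.KontsevichZagierPeriods.Zeta5Search.BrickLambdaLocality

open Finset Nat WithZero
open Summit.KontsevichZagierPeriods.Zeta5Search.BrickTopCoefficient (cTop)
open Summit.KontsevichZagierPeriods.Zeta5Search.BrickLambda (cTop_zero_ne_zero padicValuation_two le_one_of_cong)
open Summit.KontsevichZagierPeriods.Zeta5Search.BrickResidueLawMain (cong_mul_le)
open Summit.KontsevichZagierPeriods.Zeta5Search.GaussWilsonBlock (unitFactorial unitBlockProd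
  unitFactorial_shift_iter)
open Summit.KontsevichZagierPeriods.Zeta5Search.BrickLambdaClosedForm (unitPart gainPart padicValuation_unitPart
  lambda_mul_unitPart padicValuation_unitFactorial)
open Literature.NumberTheory.LFunctions (padicValuation_natCast_eq_one padicValuation_natCast_le_one)

variable {p : ℕ} [Fact p.Prime]

/-! ## LEMMA 3 (v): digit-locality -/

/-- Powers of congruences mod `g`: `v(x^m − y^m) ≤ g` from `v(x − y) ≤ g`, `x, y ∈ ℤ_(p)`. -/
theorem cong_pow_le {x y : ℚ} {g : WithZero (Multiplicative ℤ)} (h : Rat.padicValuation p (x - y) ≤ g)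
    (hx : Rat.padicValuation p x ≤ 1) (hy : Rat.padicValuation p y ≤ 1) (m : ℕ) :
    Rat.padicValuation p (x ^ m - y ^ m) ≤ g := by
  induction m with
  | zero => rw [pow_zero, pow_zero, sub_self, map_zero]; exact _root_.zero_le
  | succ m ih =>
    rw [pow_succ, pow_succ]
    exact cong_mul_le ih h (by rw [map_pow]; exact pow_le_one' hx m) hy

/-- An equality in `ZMod (p^k)` of two naturals is a congruence of valuation `≤ exp(−k)` in `ℚ`. -/
theorem padicValuation_sub_le_of_zmod_eq {a b k : ℕ} (h : (a : ZMod (p ^ k)) = b) :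
    Rat.padicValuation p ((a : ℚ) - b) ≤ exp (-(k : ℤ)) := by
  have hdvd : ((p ^ k : ℕ) : ℤ) ∣ (a : ℤ) - b := (Nat.modEq_iff_dvd.1 ((ZMod.natCast_eq_natCast_iff _ _ _).1 h).symm)
  obtain ⟨c, hc⟩ := hdvd
  rw [show (a : ℚ) - b = (((a : ℤ) - b : ℤ) : ℚ) by push_cast; ring, hc]
  push_cast
  rw [map_mul, map_pow, Rat.padicValuation_self, ← exp_nsmul, nsmul_eq_mul, mul_neg_one, Rat.padicValuation_cast]
  calc _ ≤ exp (-(k : ℤ)) * 1 := mul_le_mul' le_rfl (Int.padicValuation_le_one _ _)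
    _ = _ := mul_one _

section locality

variable (hp2 : p ≠ 2) {A B j₀ m₀ J M J' M' e q : ℕ} (hJM : J' + M' = J + M) (hq : J' * p = J * p + p ^ e * q)
  (he : 1 ≤ e)
include hp2 hJM hq he

omit [Fact p.Prime] hp2 he in
/-- The shift relations of the cell `j' = j + p^e q`: `(n−j) = (n−j') + p^e q` at the level of the digit `M`. -/
theorem sub_shift : M * p = M' * p + p ^ e * q := by
  have := congrArg (· * p) hJM; simp only [add_mul] at this; omega

/-- **The unit parts agree mod `p^e`**: `U_{j'} ≡ U_j` (the signs `(−1)^q` of the Wilson blocks cancel in pairs). -/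
theorem unitPart_zmod_eq : (unitPart p A B j₀ m₀ J' M' : ZMod (p ^ e)) = (unitPart p A B j₀ m₀ J M : ZMod (p ^ e)) := by
  have hp : p.Prime := Fact.out
  have h3 : 3 ≤ p := by have := hp.two_le; omega
  have hMq := sub_shift hJM hq
  have s1 : (unitFactorial p (j₀ + J' * p) : ZMod (p ^ e)) = (-1) ^ q * unitFactorial p (j₀ + J * p) := by
    rw [show j₀ + J' * p = (j₀ + J * p) + p ^ e * q by rw [add_assoc, ← hq], unitFactorial_shift_iter p e _ q hp h3 he]
  have s2 : (unitFactorial p (m₀ + M * p) : ZMod (p ^ e)) = (-1) ^ q * unitFactorial p (m₀ + M' * p) := by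
    rw [show m₀ + M * p = (m₀ + M' * p) + p ^ e * q by rw [add_assoc, ← hMq], unitFactorial_shift_iter p e _ q hp h3 he]
  unfold unitPart
  rw [hJM]
  push_cast
  rw [s1, s2]
  ring

/-- **The gained parts agree mod `p^e`**: `Y_{j'} ≡ Y_j` (the gained members move by `p^e q`; the blocks' signs cancel). -/
theorem gainPart_zmod_eq : (gainPart p A B j₀ m₀ J' M' : ZMod (p ^ e)) = (gainPart p A B j₀ m₀ J M : ZMod (p ^ e)) := by
  have hp : p.Prime := Fact.out
  have h3 : 3 ≤ p := by have := hp.two_le; omega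
  have hMq := sub_shift hJM hq
  have hpe : ((p : ZMod (p ^ e)) ^ e) = 0 := by rw [← Nat.cast_pow, ZMod.natCast_self]
  have s3 : (unitFactorial p (j₀ + m₀ + (J + M) * p + (j₀ + J' * p)) : ZMod (p ^ e)) =
      (-1) ^ q * unitFactorial p (j₀ + m₀ + (J + M) * p + (j₀ + J * p)) := by
    rw [show j₀ + m₀ + (J + M) * p + (j₀ + J' * p) = (j₀ + m₀ + (J + M) * p + (j₀ + J * p)) + p ^ e * q by
      rw [hq]; ring, unitFactorial_shift_iter p e _ q hp h3 he]
  have s4 : (unitFactorial p (m₀ + M * p + (j₀ + m₀ + (J + M) * p)) : ZMod (p ^ e)) =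
      (-1) ^ q * unitFactorial p (m₀ + M' * p + (j₀ + m₀ + (J + M) * p)) := by
    rw [show m₀ + M * p + (j₀ + m₀ + (J + M) * p) = (m₀ + M' * p + (j₀ + m₀ + (J + M) * p)) + p ^ e * q by
      rw [hMq]; ring, unitFactorial_shift_iter p e _ q hp h3 he]
  have e5 : p * (J + M + J' + 1) = p * (J + M + J + 1) + p ^ e * q := by
    calc p * (J + M + J' + 1) = p * (J + M) + J' * p + p := by ring
      _ = p * (J + M) + (J * p + p ^ e * q) + p := by rw [hq]
      _ = _ := by ring
  have e6 : p * (J + M + M + 1) = p * (J + M + M' + 1) + p ^ e * q := by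
    calc p * (J + M + M + 1) = p * (J + M) + M * p + p := by ring
      _ = p * (J + M) + (M' * p + p ^ e * q) + p := by rw [hMq]
      _ = _ := by ring
  have s5 : (p : ZMod (p ^ e)) * ((J + M + J' + 1 : ℕ) : ZMod (p ^ e)) =
      (p : ZMod (p ^ e)) * ((J + M + J + 1 : ℕ) : ZMod (p ^ e)) := by
    rw [← Nat.cast_mul, ← Nat.cast_mul, e5, Nat.cast_add, Nat.cast_mul (p ^ e), Nat.cast_pow, hpe, zero_mul, add_zero]
  have s6 : (p : ZMod (p ^ e)) * ((J + M + M + 1 : ℕ) : ZMod (p ^ e)) =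
      (p : ZMod (p ^ e)) * ((J + M + M' + 1 : ℕ) : ZMod (p ^ e)) := by
    rw [← Nat.cast_mul, ← Nat.cast_mul, e6, Nat.cast_add, Nat.cast_mul (p ^ e), Nat.cast_pow, hpe, zero_mul, add_zero]
  unfold gainPart
  rw [hJM]
  simp only [Nat.cast_mul, Nat.cast_pow]
  rw [s3, s4, s5, s6]
  ring

include hp2 in
/-- **LEMMA 3 (v), DIGIT-LOCALITY of the multiplier** (° cells, `A` even, odd `p`): for the cells `j = j₀ + Jp` and
`j' = j₀ + J'p = j + p^e·q` (`e ≥ 1`) of the row `n = n₀ + Np` (`n₀ = j₀ + m₀ < p`, `N = J + M = J' + M'`) and any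
`λ, λ'` with `λ·c̃_{J,A}(N) = c_{j,A}(n)`, `λ'·c̃_{J',A}(N) = c_{j',A}(n)`: `v(λ' − λ) ≤ exp(−e)`. -/
theorem lambda_digit_local (hA : Even A) (hn₀ : j₀ + m₀ < p) {ε : ℕ} {lam lam' : ℚ}
    (hlam : lam * cTop A B 0 (J + M) J = cTop A B ε (j₀ + m₀ + (J + M) * p) (j₀ + J * p))
    (hlam' : lam' * cTop A B 0 (J' + M') J' = cTop A B ε (j₀ + m₀ + (J' + M') * p) (j₀ + J' * p)) :
    Rat.padicValuation p (lam' - lam) ≤ exp (-(e : ℤ)) := by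
  have hp : p.Prime := Fact.out
  -- the closed forms, with the common sign (A even)
  have hL := lambda_mul_unitPart (p := p) (A := A) (B := B) (ε := ε) hn₀ hlam
  have hL' := lambda_mul_unitPart (p := p) (A := A) (B := B) (ε := ε) hn₀ hlam'
  have hsgn : ∀ x y N : ℕ, ((-1 : ℚ) ^ ((j₀ + m₀ + (J + M) * p) * B + x * A)) * (-1) ^ (N * B + y * A) =
      (-1) ^ ((j₀ + m₀ + (J + M) * p) * B) * (-1) ^ (N * B) := by
    intro x y N
    rw [pow_add, pow_add, (hA.mul_left x).neg_one_pow, (hA.mul_left y).neg_one_pow, mul_one, mul_one]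
  rw [hsgn] at hL
  rw [hJM, hsgn] at hL'
  set σ : ℚ := (-1) ^ ((j₀ + m₀ + (J + M) * p) * B) * (-1) ^ ((J + M) * B) with hσ
  set c : ℚ := (((j₀ + m₀ + (J + M) * p : ℕ) : ℚ) / 2 - ((j₀ + J * p : ℕ) : ℚ)) with hc
  set c' : ℚ := (((j₀ + m₀ + (J + M) * p : ℕ) : ℚ) / 2 - ((j₀ + J' * p : ℕ) : ℚ)) with hc'
  -- valuations
  have vU := padicValuation_unitPart (p := p) A B j₀ m₀ J M
  have vU' := padicValuation_unitPart (p := p) A B j₀ m₀ J' M'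
  have hU0 : (unitPart p A B j₀ m₀ J M : ℚ) ≠ 0 := fun h => by rw [h, map_zero] at vU; exact zero_ne_one vU
  have hU'0 : (unitPart p A B j₀ m₀ J' M' : ℚ) ≠ 0 := fun h => by rw [h, map_zero] at vU'; exact zero_ne_one vU'
  have vUU : Rat.padicValuation p ((unitPart p A B j₀ m₀ J M : ℚ) - unitPart p A B j₀ m₀ J' M') ≤ exp (-(e : ℤ)) := by
    rw [Valuation.map_sub_swap]; exact padicValuation_sub_le_of_zmod_eq (unitPart_zmod_eq hp2 hJM hq he)
  have vYY : Rat.padicValuation p ((gainPart p A B j₀ m₀ J' M' : ℚ) - gainPart p A B j₀ m₀ J M) ≤ exp (-(e : ℤ)) :=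
    padicValuation_sub_le_of_zmod_eq (gainPart_zmod_eq hp2 hJM hq he)
  have hcen : ∀ x : ℕ, Rat.padicValuation p ((((j₀ + m₀ + (J + M) * p : ℕ) : ℚ)) / 2 - (x : ℚ)) ≤ 1 := by
    intro x
    rw [show (((j₀ + m₀ + (J + M) * p : ℕ) : ℚ)) / 2 - (x : ℚ) = ((((j₀ + m₀ + (J + M) * p : ℕ) : ℤ) - 2 * x : ℤ) : ℚ) / 2
      by push_cast; ring, map_div₀, padicValuation_two hp2, div_one, Rat.padicValuation_cast]
    exact Int.padicValuation_le_one _ _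
  have hc1 : Rat.padicValuation p c ≤ 1 := by rw [hc]; exact_mod_cast hcen (j₀ + J * p)
  have hc'1 : Rat.padicValuation p c' ≤ 1 := by rw [hc']; exact_mod_cast hcen (j₀ + J' * p)
  have hcc : Rat.padicValuation p (c' - c) ≤ exp (-(e : ℤ)) := by
    have : c' - c = -((p : ℚ) ^ e * q) := by
      have hq' : ((j₀ + J' * p : ℕ) : ℚ) = ((j₀ + J * p : ℕ) : ℚ) + (p : ℚ) ^ e * q := by
        exact_mod_cast (by rw [hq]; ring : j₀ + J' * p = j₀ + J * p + p ^ e * q)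
      rw [hc, hc', hq']; ring
    rw [this, Valuation.map_neg, map_mul, map_pow, Rat.padicValuation_self, ← exp_nsmul, nsmul_eq_mul, mul_neg_one]
    calc _ ≤ exp (-(e : ℤ)) * 1 := mul_le_mul' le_rfl (padicValuation_natCast_le_one q)
      _ = _ := mul_one _
  have hσv : Rat.padicValuation p σ = 1 := by
    rw [hσ, map_mul, map_pow, map_pow, Valuation.map_neg, map_one, one_pow, one_pow, mul_one]
  -- assembling
  have hlamq : lam = σ * c ^ ε * (gainPart p A B j₀ m₀ J M : ℚ) / unitPart p A B j₀ m₀ J M := by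
    rw [eq_div_iff hU0, hL]
  have hlamq' : lam' = σ * c' ^ ε * (gainPart p A B j₀ m₀ J' M' : ℚ) / unitPart p A B j₀ m₀ J' M' := by
    rw [eq_div_iff hU'0, hL']
  rw [hlamq', hlamq, div_sub_div _ _ hU'0 hU0, map_div₀, map_mul, vU, vU', mul_one, div_one,
    show σ * c' ^ ε * (gainPart p A B j₀ m₀ J' M' : ℚ) * unitPart p A B j₀ m₀ J M -
        unitPart p A B j₀ m₀ J' M' * (σ * c ^ ε * (gainPart p A B j₀ m₀ J M : ℚ)) =
      σ * (c' ^ ε * (gainPart p A B j₀ m₀ J' M' : ℚ) * unitPart p A B j₀ m₀ J M -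
        c ^ ε * (gainPart p A B j₀ m₀ J M : ℚ) * unitPart p A B j₀ m₀ J' M') by ring, map_mul, hσv, one_mul]
  refine cong_mul_le (cong_mul_le (cong_pow_le hcc hc'1 hc1 ε) vYY ?_ (padicValuation_natCast_le_one _)) vUU ?_
    (padicValuation_natCast_le_one _)
  · rw [map_pow]; exact pow_le_one' hc'1 ε
  · rw [map_mul, map_pow]; exact mul_le_one' (pow_le_one' hc'1 ε) (padicValuation_natCast_le_one _)

end locality

/-- **LEMMA 3 (v) in standard digit form**: row `n = n₀ + Np` (`n₀ < p`), ° cells `k = k₀ + Kp`, `k' = k₀ + K'p` with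
`k₀ ≤ n₀`, `K, K' ≤ N` and `K'p = Kp + p^e·q` (`e ≥ 1`); `A` even, odd `p`: `v(λ_{k'} − λ_k) ≤ exp(−e)` for any
multipliers `λ·c̃_{K,A}(N) = c_{k,A}(n)`, `λ'·c̃_{K',A}(N) = c_{k',A}(n)`. -/
theorem lambda_digit_local_std (hp2 : p ≠ 2) {A B ε n₀ N k₀ K K' e q : ℕ} (hA : Even A) (hn₀ : n₀ < p) (hk₀ : k₀ ≤ n₀)
    (hK : K ≤ N) (hK' : K' ≤ N) (hq : K' * p = K * p + p ^ e * q) (he : 1 ≤ e) {lam lam' : ℚ}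
    (hlam : lam * cTop A B 0 N K = cTop A B ε (n₀ + N * p) (k₀ + K * p))
    (hlam' : lam' * cTop A B 0 N K' = cTop A B ε (n₀ + N * p) (k₀ + K' * p)) :
    Rat.padicValuation p (lam' - lam) ≤ exp (-(e : ℤ)) := by
  obtain ⟨m₀, rfl⟩ := Nat.exists_eq_add_of_le hk₀
  obtain ⟨M, rfl⟩ := Nat.exists_eq_add_of_le hK
  obtain ⟨M', hM'⟩ := Nat.exists_eq_add_of_le hK'
  have hJM : K' + M' = K + M := hM'.symm
  rw [hM'] at hlam'
  exact lambda_digit_local hp2 hJM hq he hA (by omega) hlam hlam'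


end Summit.KontsevichZagierPeriods.Zeta5Search.BrickLambdaLocality
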